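import Summits.QuantumFields.YangMills.Theorems.BalabanUVNodesN11NoExpansionZetaSpecAtCoP
import Summits.QuantumFields.YangMills.Theorems.BalabanUVNodesN11NoExpansionRoughFibre
import Literature.MathematicalPhysics.QuantumFieldTheory.Balaban1983to89.Node00.LargeFieldBackgroundCoPOfRecordFaces
import Literature.MathematicalPhysics.QuantumFieldTheory.Balaban1983to89.Node00.LargeFieldBackgroundCoPOfRecordFacesB
import Summits.QuantumFields.YangMills.Theorems.BalabanUVNodesN11BackgroundCoPMeasurableB

/-!
# DAG node N11 — THE NO-EXPANSION EQUATIONS OF (S1ᵀ)₁₃ RE-KEYED AT THE v1.5 `CoP` RECORD: what `TLaw₁₃CoP θ p k` DEMANDS at the all-large-field new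
# sequences, at 12a″'s weights `WtOfRecord₁₃P` and node00-def-R's support-edition background `UbgOfRecord₁₃CoP` — level 1 TERM-FREE AND REGULARITY-FREE
# (`T[w(s′)ρ₀] =ᵐ T[ζ0_0(T)·e^{−½quad_0(∅)}·e^{E−E_1}·ρ₀]`; at K0b's residual: `=ᵐ (#{Y})⁻¹e^{E−E_1}·T[ρ₀]`), the backgrounds UNCHANGED along a no-expansion
# step (the level-(k+1) coherence equation is the sequel file)

Cell `pub-ymgap`, YM-PLAN Track A (HUMAN RULING D-0062), seat `pub-ymgap-dag-n11-d` (g7; R134 fan-out seat N11 [B14], strategy s2), route `BalabanUVNodes`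
rev 21, item K1⁵ `StabilityBAtRecordR13SepCoP` = stmt-QuantumFields-20294 (helper, count-neutral; dag-lead WORDS-141).  [III] = [Balaban1988Convergent].
The `CoP` twin of this seat's `Node00.TkNoExpansionAtRecord13` (p490716; 12a weights, `T_η`-edition background) — dag-lead ORPHAN-STOREYS «N11
`TkNoExpansion*` — self re-key» — over the sibling files `BalabanUVNodesN11NoExpansionZetaSpec` (p522000) ∕ `…ZetaSpecAtCoP` (the SUFFICIENCY half and the
support-edition background at `Ω₁ = ∅`) and this seat's `BalabanUVNodesN11NoExpansionTermFree` (p495297: the (2.23) action along the all-large-field history).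

WHY THIS FILE.  FINDING №7's cure F7 (director-ym №160–№162) re-read the 𝐓-image law at NEW objects: `TLaw₁₃CoP` (FILE 23 `Node00/Record13CoP`) over
`WtOfRecord₁₃P := tkWeightsOfRecordP … (θ.Zt p.K)` (12a″: `ζ := ζ0`, NO regularity factor) and `UbgOfRecord₁₃CoP … (n+1) := UbgMSCoPOfRecord …` (FILE 22′: the
(2.12) class posed on the support `Ω₀ = hullD(Ω₁)` only).  The located content this seat extracted from (S1ᵀ) at the earlier records — what the law DEMANDS of a
witness's residual 𝐓-weights on the NO-EXPANSION histories — is re-keyed here so that the K0⁵∕K1⁵ lanes read it at the objects they now use, and it comes out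
SHARPER: at the all-large-field new sequence `s′` of length 1 the background of record reads the fine field for EVERY retained configuration (sibling file:
no class hypothesis, no junk branch) and the operand is term-free (p495297), so the (S1ᵀ)₁₃CoP,₀ clause at `s′` is EXACTLY the transport equation
`∫dU δ(ŪV₁⁻¹) w(s′)(U,V₁)ρ₀(U) = e^{E(p)−E_1} ∫dU δ(ŪV₁⁻¹) ζ0_0(T)(U,V₁)·e^{−½quad_0(∅)(U,V₁)}·ρ₀(U)` for `dV₁`-a.e. `V₁` (or `slotT_1(s′) ≡ 0`) — NO regularity
letter, NO 𝐄-term, NO class: def-T's resummed step weight against the witness's residual factor under the block-averaging disintegration, ONE free constant.  At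
K0b's residual of record (`ζ0 ≡ (#{Y})⁻¹`, `quad ≡ 0`) it reads `T[w(s′)ρ₀] =ᵐ (#{Y})⁻¹e^{E−E_1}·T[ρ₀]`: «the conditional expectation of `w(s′)(U,Ū)` given `Ū` under
`ρ₀dU` is an a.e. CONSTANT» — the located witness-side condition (K0a's pen; the sibling files give the pin that meets the identity instead).  §2–§3 re-key the
no-expansion bookkeeping one level up: the support-edition background is UNCHANGED along a no-expansion step (`k ≥ 1`: same support, same class, same determining
set; `k = 0`: `U_1(s′) = U_0(init s′) = 𝐖 0` for EVERY `𝐖`), and the level-(k+1) coherence equation at the `CoP` objects.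

WHAT THIS FILE PROVES (0 `sorry`, 0 `def`, standard axioms; `N`-generic; `θ : Stage13Params F N` arbitrary, run `p`).
§1 LEVEL 1: `noExpIntegrand_WtOfRecord₁₃P_sect2Operand_of_Omega_empty`
(the integrand at the `CoP` objects, closed form, EVERY configuration); `tLaw₁₃CoP_zero_clause_of_Omega_empty`; ★ `tLaw₁₃CoP_zero_coherence_of_Omega_empty` (the equation
above from `TLaw₁₃CoP θ p 0`, displayed joint measurability ∕ bound of `ζ0_0(T)·e^{−½quad_0(∅)}` only); ★★ `tLaw₁₃CoP_zero_coherence_of_Zt_eq_ZtOfRecord` (at K0b's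
residual: `slotT_1(s′) ≡ 0 ∨ T[w(s′)ρ₀] =ᵐ (#{Y})⁻¹e^{E−E_1}·T[ρ₀]`, NO displayed proviso but `0 < K`, `1 ≤ M`) and `…_of_hasResidualsOfRecord`.  §2 BACKGROUNDS (over
node00-def-R's faces `Node00/LargeFieldBackgroundCoPOfRecordFaces` p~ — `regMSCoPOfRecord_succ_eq_of_Omega_empty`, `UbgMSCoPOfRecord_one_of_Omega_empty`, cited by name):
`UbgMSCoPOfRecord_succ_eq_init_of_Omega_empty` (`k ≥ 1`), `UbgOfRecord₁₃CoP_succ_eq_init_of_Omega_empty` (`k ≥ 1`), `UbgOfRecord₁₃CoP_one_eq_init_of_Omega_empty` (`k = 0`, EVERY `𝐖`).  The LEVEL-(k+1) storey (`slotsTOfRecord_succ_of_sLaw₁₃CoP`, the coherence equation) is the sequel file `…NoExpansionAtRecord13CoPSucc`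
(400-line rule).

EDITION (Stage-2 train, WORKPLAN-IIIB (iii-b), director-ym №343 (D5)∕(D6), row TRAIN-N11, seat dag-n11-d g41): §Backgrounds gains the print-datum twin
`UbgMSCoPOfRecordB_succ_eq_init_of_Omega_empty` (node00-def-R's S2b∕S2c + this seat's `…N11BackgroundCoPMeasurableB` §5), and the record-level `UbgOfRecord₁₃CoP_succ_eq_init_of_Omega_empty` ∕
`UbgOfRecord₁₃CoP_one_eq_init_of_Omega_empty` are re-proved SEAM-ROBUSTLY (`apply_rules` over the (b) face and its twin): statements byte-identical; they elaborate BEFORE and AFTER the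
`Record13CoP` seam edit (FLAG №16 ∕ LOCATE-HSEAM 5d3298b8d191f169); every (b)-statement here stays landed and true.

HONEST SCOPE.  Count-neutral kernel bookkeeping on the tree's OWN objects; a BY-NAME RE-KEY of this seat's no-expansion storeys at the v1.5 record plus the two
faces F7 made unconditional.  NECESSARY conditions read off `TLaw₁₃CoP` — NOT a proof that it holds or fails at any witness (whether the constant-conditional-
expectation condition holds at K0b's residual is a positivity ∕ fibre question about def-T's (3.2)∕(3.3) labels through def-R's classical-choice local backgrounds
that the tree does not decide); nothing of Bałaban's asserted.  N11 NOT discharged; counts unmoved (typed 28∕28 · discharged 5∕28).  One finite four-torus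
programme at fixed `ε = L^{−K}`; NOT ℝ⁴, NOT OS, NOT a mass gap, NOT Clay.  Sources: [III] (1.11) p. 248, (2.2) p. 255, (2.12)–(2.13) pp. 256–257, (2.17)–(2.18)
p. 257, (2.21)–(2.23) p. 258, (3.1) p. 264, (3.16) p. 268, (3.24)–(3.25) p. 270, Theorem p. 245, Thm 1 p. 262; [Balaban1985Variational] (2),(5)–(6) p. 278.
-/

noncomputable section

open MeasureTheory
open scoped BigOperators Matrix.Norms.L2Operator

namespace Summit.QuantumFields.YangMills.Theorems.BalabanUVNodesN11NoExpansionAtRecord13CoP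

open Literature.MathematicalPhysics.QuantumFieldTheory.Balaban1983to89 T4Continuum Node00 Node00.Tk DagBinding
open B15DeterminingSets B15DeterminingSetsB
open BalabanUVNodesN11BackgroundCoPMeasurableB (lamBondsSeq_succ_eq_of_Omega_empty_of_agree)
open BalabanUVNodesN11NoExpansionTermFree (exp_action23_one_eq_rhoZero_of_Omega_empty₁₃)
open BalabanUVNodesN11NoExpansionZetaSpec (noExpIntegrand_eq_zetaFactor_mul sect2Slot_one_ae_eq_transport_of_Omega_empty)
open BalabanUVNodesN11NoExpansionZetaSpecAtCoP (UbgOfRecord₁₃CoP_one_pairCfg_of_Omega_empty WtOfRecord₁₃P_ζ_zero_univ WtOfRecord₁₃P_w_zero_empty)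
open BalabanUVNodesN11NoExpansionRoughFibre (transportOfRecord_const_mul)

variable {F : T4Family} {N : ℕ} [NeZero N]

/-! ## §1. LEVEL 1 at the `CoP` record: the (S1ᵀ)₁₃CoP,₀ clause at the all-large-field sequence as a TERM-FREE, REGULARITY-FREE transport equation -/

section LevelOne

variable (θ : Stage13Params F N) (p : B12.RunParams)

/-- **THE NO-EXPANSION INTEGRAND AT THE `CoP` OBJECTS OF RECORD, CLOSED FORM, AT EVERY TWO-SCALE CONFIGURATION** (`M ≥ 1`, `Ω₁(s′) = ∅`): 12a″'s factor
`ζ0_0(T)(U,V₁)·e^{−½quad_0(∅)(U,V₁)}` (NO regularity factor) times the term-free operand `e^{E(p)−E_1}·ρ₀(U)` at def-R's support-edition background, which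
reads the fine field for EVERY `𝐖` (sibling file `UbgOfRecord₁₃CoP_one_pairCfg_of_Omega_empty` — no class hypothesis, no junk branch).
[cite: Balaban1988Convergent, (1.11) p.248, (2.18) p.257, (2.21)–(2.23) p.258, (2.12) p.256, Thm 1 p.262] -/
theorem noExpIntegrand_WtOfRecord₁₃P_sect2Operand_of_Omega_empty (hM : 1 ≤ θ.τ9.M)
    (s : SeqOfRecord F θ.ν θ.τ9.M (gOfRecord₁₃ F N θ p) p.K 1) (hΩ : s.Ω 1 = ∅)
    (t : Sect2.TermValues (F.P p.K) (MatA N) (FluctV N) θ.τ9.M) (Ek : ℝ)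
    (V1 : GaugeField (F.P p.K) 1 (SU N)) (Uf : GaugeField (F.P p.K) 0 (SU N)) :
    noExpIntegrand F N (FluctV N) p.K (WtOfRecord₁₃P F N θ p)
        (sect2Operand F N (FluctV N) p.K (settingOfRecord₁₃ F N θ p) (θ.Rz p.K) s t Ek (UbgOfRecord₁₃CoP F N θ p 1 s)) V1 Uf =
      ((θ.Zt p.K).ζ0 0 Set.univ (pairCfg (V := FluctV N) V1 Uf) * Real.exp (-(1 / 2 : ℝ) * (θ.Zt p.K).quad 0 ∅ (pairCfg (V := FluctV N) V1 Uf))) *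
        (Real.exp (EOfRecord₁₃ F N θ p - Ek) * rhoZeroOfRecord F N p.K p.g0 (EOfRecord₁₃ F N θ p) Uf) := by
  rw [BalabanUVNodesN11NoExpansionZetaSpec.noExpIntegrand_sect2Operand_of_bg_eq θ p hM s hΩ (WtOfRecord₁₃P F N θ p) t Ek
    (UbgOfRecord₁₃CoP F N θ p 1 s) V1 Uf (UbgOfRecord₁₃CoP_one_pairCfg_of_Omega_empty θ p s hΩ V1 Uf),
    WtOfRecord₁₃P_ζ_zero_univ, WtOfRecord₁₃P_w_zero_empty]

/-- **THE (S1ᵀ)₁₃CoP,₀ CLAUSE AT THE ALL-LARGE-FIELD SEQUENCE, GUARD-FREE**: if `TLaw₁₃CoP θ p 0` holds, its witness `(t, E_1)` satisfies at `s′` with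
`Ω₁(s′) = ∅` «`slotT_1(s′)` is the zero function, or `slotT_1(s′)(V₁) = 𝐓_1(s′)e^{A_1(s′)}(V₁)` for `dV₁`-a.e. `V₁`» (`χ_1(s′) ≡ 1` there).
[cite: Balaban1988Convergent, (3.25) p.270, remark p.262, Theorem p.245] -/
theorem tLaw₁₃CoP_zero_clause_of_Omega_empty (hT : TLaw₁₃CoP F N θ p 0)
    (s : SeqOfRecord F θ.ν θ.τ9.M (gOfRecord₁₃ F N θ p) p.K 1) (hΩ : s.Ω 1 = ∅) :
    ∃ (t : SeqOfRecord F θ.ν θ.τ9.M (gOfRecord₁₃ F N θ p) p.K 1 → Sect2.TermValues (F.P p.K) (MatA N) (FluctV N) θ.τ9.M)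
      (Ek : SeqOfRecord F θ.ν θ.τ9.M (gOfRecord₁₃ F N θ p) p.K 1 → ℝ),
      Sect2.UniversalE t ∧
      (∀ s', Sect2.LawsT (sect2TowerOfRecord F N (FluctV N) p.K (settingOfRecord₁₃ F N θ p) (θ.Rz p.K) s' (t s'))
        (settingOfRecord₁₃ F N θ p).lf (settingOfRecord₁₃ F N θ p).βc 0) ∧
      (slotsTOfRecord F N θ.ν θ.τ9 (EOfRecord₁₃ F N θ) (wOfRecord₉ F N θ.toStage9Params) θ.ppSel p
          (gOfRecord₁₃ F N θ p) 1 s = 0 ∨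
        ∀ᵐ V1 ∂fieldMeasure (F.P p.K) 1 (SU N),
          slotsTOfRecord F N θ.ν θ.τ9 (EOfRecord₁₃ F N θ) (wOfRecord₉ F N θ.toStage9Params) θ.ppSel p
              (gOfRecord₁₃ F N θ p) 1 s V1 =
            sect2Slot F N (FluctV N) p.K (settingOfRecord₁₃ F N θ p) (θ.Rz p.K) (WtOfRecord₁₃P F N θ p) s (t s) (Ek s)
              (UbgOfRecord₁₃CoP F N θ p 1 s) V1) := by
  obtain ⟨t, Ek, hu, hs⟩ := (tLaw₁₃CoP_iff F N θ p 0).mp hT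
  refine ⟨t, Ek, hu, fun s' => (hs s').1, ?_⟩
  rcases (hs s).2 with h0 | hid
  · exact Or.inl h0
  · refine Or.inr ?_
    filter_upwards [hid] with V1 hV1
    exact hV1 (by rw [chiSeqOfRecord_eq_one_of_Omega_empty F N θ.ν θ.τ9.M _ p.K 1 s hΩ V1]; exact one_ne_zero)

/-- **★ THE LEVEL-1 NO-EXPANSION COHERENCE EQUATION AT THE `CoP` RECORD — TERM-FREE, REGULARITY-FREE, CLASS-FREE.**  If `TLaw₁₃CoP θ p 0` holds (`0 < K`,
`1 ≤ M`; the residual factor `(V₁,U) ↦ ζ0_0(T)(U,V₁)·e^{−½quad_0(∅)(U,V₁)}` jointly measurable and bounded — displayed), then at the all-large-field new sequence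
`s′`, for the witness's constant `E_1 = E_1(s′)`, EITHER `slotT_1(s′) ≡ 0` OR, for `dV₁`-a.e. `V₁`,
`∫dU δ(ŪV₁⁻¹) w(s′)(U,V₁)·ρ₀(U) = e^{E(p)−E_1}·∫dU δ(ŪV₁⁻¹) ζ0_0(T)(U,V₁)·e^{−½quad_0(∅)(U,V₁)}·ρ₀(U)` — def-T's resummed step weight against the witness's
residual factor under the block-averaging disintegration: NO 𝐄-term (p495297), NO `χreg` (12a″), NO class ∕ junk branch (22′ at `Ω₁ = ∅`), ONE free constant.
By transport duality: «`E[ρ₀·(w(s′)(·,V₁) − e^{E−E_1}·ζ0_0(T)e^{−½quad_0(∅)}) | Ū = V₁] = 0` a.s.».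
[cite: Balaban1988Convergent, Theorem p.245, (3.1) p.264, (3.25) p.270, (1.11) p.248, (2.21)–(2.23) p.258, Thm 1 p.262] -/
theorem tLaw₁₃CoP_zero_coherence_of_Omega_empty (hK : 0 < p.K) (hM : 1 ≤ θ.τ9.M) (hT : TLaw₁₃CoP F N θ p 0)
    (s : SeqOfRecord F θ.ν θ.τ9.M (gOfRecord₁₃ F N θ p) p.K 1) (hΩ : s.Ω 1 = ∅) {B : ℝ}
    (hmZ : Measurable (Function.uncurry fun (V1 : GaugeField (F.P p.K) 1 (SU N)) (Uf : GaugeField (F.P p.K) 0 (SU N)) =>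
      (θ.Zt p.K).ζ0 0 Set.univ (pairCfg (V := FluctV N) V1 Uf) * Real.exp (-(1 / 2 : ℝ) * (θ.Zt p.K).quad 0 ∅ (pairCfg (V := FluctV N) V1 Uf))))
    (hBZ : ∀ (V1 : GaugeField (F.P p.K) 1 (SU N)) (Uf : GaugeField (F.P p.K) 0 (SU N)),
      |(θ.Zt p.K).ζ0 0 Set.univ (pairCfg (V := FluctV N) V1 Uf) * Real.exp (-(1 / 2 : ℝ) * (θ.Zt p.K).quad 0 ∅ (pairCfg (V := FluctV N) V1 Uf))| ≤ B) :
    ∃ Ek : ℝ,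
      slotsTOfRecord F N θ.ν θ.τ9 (EOfRecord₁₃ F N θ) (wOfRecord₉ F N θ.toStage9Params) θ.ppSel p
          (gOfRecord₁₃ F N θ p) 1 s = 0 ∨
        (fun V1 => transportOfRecord F N p.K 0 (fun U => wOfRecord₉ F N θ.toStage9Params p (gOfRecord₁₃ F N θ p) 0 s U V1 *
            rhoZeroOfRecord F N p.K (gOfRecord₁₃ F N θ p 0) (EOfRecord₁₃ F N θ p) U) V1)
          =ᵐ[fieldMeasure (F.P p.K) 1 (SU N)]
        fun V1 => Real.exp (EOfRecord₁₃ F N θ p - Ek) *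
          transportOfRecord F N p.K 0 (fun Uf =>
            ((θ.Zt p.K).ζ0 0 Set.univ (pairCfg (V := FluctV N) V1 Uf) *
                Real.exp (-(1 / 2 : ℝ) * (θ.Zt p.K).quad 0 ∅ (pairCfg (V := FluctV N) V1 Uf))) *
              rhoZeroOfRecord F N p.K p.g0 (EOfRecord₁₃ F N θ p) Uf) V1 := by
  obtain ⟨t, Ekf, -, -, hcl⟩ := tLaw₁₃CoP_zero_clause_of_Omega_empty θ p hT s hΩ
  refine ⟨Ekf s, ?_⟩
  rcases hcl with h0 | hid
  · exact Or.inl h0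
  · refine Or.inr ?_
    -- the closed form of the integrand, everywhere
    have hint := noExpIntegrand_WtOfRecord₁₃P_sect2Operand_of_Omega_empty θ p hM s hΩ (t s) (Ekf s)
    have hfun : Function.uncurry (noExpIntegrand F N (FluctV N) p.K (WtOfRecord₁₃P F N θ p)
          (sect2Operand F N (FluctV N) p.K (settingOfRecord₁₃ F N θ p) (θ.Rz p.K) s (t s) (Ekf s) (UbgOfRecord₁₃CoP F N θ p 1 s))) =
        fun z => (Function.uncurry (fun (V1 : GaugeField (F.P p.K) 1 (SU N)) (Uf : GaugeField (F.P p.K) 0 (SU N)) =>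
            (θ.Zt p.K).ζ0 0 Set.univ (pairCfg (V := FluctV N) V1 Uf) *
              Real.exp (-(1 / 2 : ℝ) * (θ.Zt p.K).quad 0 ∅ (pairCfg (V := FluctV N) V1 Uf))) z) *
          (Real.exp (EOfRecord₁₃ F N θ p - Ekf s) * rhoZeroOfRecord F N p.K p.g0 (EOfRecord₁₃ F N θ p) z.2) := by
      funext z
      rcases z with ⟨V1, Uf⟩
      exact hint V1 Uf
    have hm' : Measurable (Function.uncurry (noExpIntegrand F N (FluctV N) p.K (WtOfRecord₁₃P F N θ p)
        (sect2Operand F N (FluctV N) p.K (settingOfRecord₁₃ F N θ p) (θ.Rz p.K) s (t s) (Ekf s) (UbgOfRecord₁₃CoP F N θ p 1 s)))) := by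
      rw [hfun]
      exact hmZ.mul (measurable_const.mul ((measurable_rhoZeroOfRecord F N p.K p.g0 (EOfRecord₁₃ F N θ p)).comp measurable_snd))
    have hC' : ∀ (V1 : GaugeField (F.P p.K) 1 (SU N)) (Uf : GaugeField (F.P p.K) 0 (SU N)),
        |noExpIntegrand F N (FluctV N) p.K (WtOfRecord₁₃P F N θ p)
          (sect2Operand F N (FluctV N) p.K (settingOfRecord₁₃ F N θ p) (θ.Rz p.K) s (t s) (Ekf s) (UbgOfRecord₁₃CoP F N θ p 1 s)) V1 Uf| ≤
          B * (Real.exp (EOfRecord₁₃ F N θ p - Ekf s) * Real.exp (-EOfRecord₁₃ F N θ p)) := by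
      intro V1 Uf
      rw [hint V1 Uf, abs_mul]
      have hB0 : 0 ≤ B := (abs_nonneg _).trans (hBZ V1 Uf)
      have hρ : |Real.exp (EOfRecord₁₃ F N θ p - Ekf s) * rhoZeroOfRecord F N p.K p.g0 (EOfRecord₁₃ F N θ p) Uf| ≤
          Real.exp (EOfRecord₁₃ F N θ p - Ekf s) * Real.exp (-EOfRecord₁₃ F N θ p) := by
        rw [abs_mul, abs_of_pos (Real.exp_pos _), abs_of_pos (rhoZeroOfRecord_pos F N p.K p.g0 _ Uf)]
        exact mul_le_mul_of_nonneg_left (rhoZeroOfRecord_le F N p.K p.g0 _ Uf) (Real.exp_pos _).le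
      exact mul_le_mul (hBZ V1 Uf) hρ (abs_nonneg _) hB0
    have h2 := sect2Slot_one_ae_eq_transport_of_Omega_empty θ p hK s hΩ (WtOfRecord₁₃P F N θ p) (t s) (Ekf s)
      (UbgOfRecord₁₃CoP F N θ p 1 s) hm' hC'
    filter_upwards [hid, h2] with V1 e1 e2
    rw [← slotsTOfRecord_one_apply, e1, e2]
    -- pull the constant `e^{E−E_1}` out of the transport
    have hrew : noExpIntegrand F N (FluctV N) p.K (WtOfRecord₁₃P F N θ p)
          (sect2Operand F N (FluctV N) p.K (settingOfRecord₁₃ F N θ p) (θ.Rz p.K) s (t s) (Ekf s) (UbgOfRecord₁₃CoP F N θ p 1 s)) V1 =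
        fun Uf => Real.exp (EOfRecord₁₃ F N θ p - Ekf s) *
          (((θ.Zt p.K).ζ0 0 Set.univ (pairCfg (V := FluctV N) V1 Uf) *
              Real.exp (-(1 / 2 : ℝ) * (θ.Zt p.K).quad 0 ∅ (pairCfg (V := FluctV N) V1 Uf))) *
            rhoZeroOfRecord F N p.K p.g0 (EOfRecord₁₃ F N θ p) Uf) := by
      funext Uf
      rw [hint V1 Uf]
      ring
    rw [hrew, transportOfRecord_const_mul]

/-- **★★ AT K0b's RESIDUAL OF RECORD THE EQUATION HAS NO RESIDUAL FACTOR LEFT**: if `θ.Zt = ZtOfRecord` (`ζ0 ≡ (#{Y})⁻¹`, `quad ≡ 0`) and `TLaw₁₃CoP θ p 0`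
holds (`0 < K`, `1 ≤ M` — NO other proviso), then at the all-large-field new sequence, for the witness's constant `E_1`, EITHER `slotT_1(s′) ≡ 0` OR
`T[w(s′)(·,V₁)ρ₀](V₁) = (#{Y})⁻¹·e^{E(p)−E_1}·T[ρ₀](V₁)` for `dV₁`-a.e. `V₁`: the transport of the step-weighted Wilson start is an a.e.-CONSTANT MULTIPLE of the
transport of the Wilson start — «`E_{ρ₀}[w(s′)(U,Ū) | Ū]` is a.e. constant».  The located witness-side condition after F7 (the sibling files give the pin
that meets the identity instead). [cite: Balaban1988Convergent, Theorem p.245, (3.1) p.264, (3.25) p.270, (3.16) p.268, (3.2)–(3.3) p.265, Thm 1 p.262] -/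
theorem tLaw₁₃CoP_zero_coherence_of_Zt_eq_ZtOfRecord (hZt : θ.Zt = ZtOfRecord F N) (hK : 0 < p.K) (hM : 1 ≤ θ.τ9.M)
    (hT : TLaw₁₃CoP F N θ p 0) (s : SeqOfRecord F θ.ν θ.τ9.M (gOfRecord₁₃ F N θ p) p.K 1) (hΩ : s.Ω 1 = ∅) :
    ∃ Ek : ℝ,
      slotsTOfRecord F N θ.ν θ.τ9 (EOfRecord₁₃ F N θ) (wOfRecord₉ F N θ.toStage9Params) θ.ppSel p
          (gOfRecord₁₃ F N θ p) 1 s = 0 ∨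
        (fun V1 => transportOfRecord F N p.K 0 (fun U => wOfRecord₉ F N θ.toStage9Params p (gOfRecord₁₃ F N θ p) 0 s U V1 *
            rhoZeroOfRecord F N p.K (gOfRecord₁₃ F N θ p 0) (EOfRecord₁₃ F N θ p) U) V1)
          =ᵐ[fieldMeasure (F.P p.K) 1 (SU N)]
        fun V1 => (((Nat.card (Set (Site (F.P p.K) 0)) : ℝ))⁻¹ * Real.exp (EOfRecord₁₃ F N θ p - Ek)) *
          transportOfRecord F N p.K 0 (rhoZeroOfRecord F N p.K p.g0 (EOfRecord₁₃ F N θ p)) V1 := by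
  have hconst : ∀ (V1 : GaugeField (F.P p.K) 1 (SU N)) (Uf : GaugeField (F.P p.K) 0 (SU N)),
      (θ.Zt p.K).ζ0 0 Set.univ (pairCfg (V := FluctV N) V1 Uf) * Real.exp (-(1 / 2 : ℝ) * (θ.Zt p.K).quad 0 ∅ (pairCfg (V := FluctV N) V1 Uf)) =
        ((Nat.card (Set (Site (F.P p.K) 0)) : ℝ))⁻¹ := by
    intro V1 Uf
    rw [hZt, ZtOfRecord_ζ0_apply, ZtOfRecord_quad_empty, mul_zero, Real.exp_zero, mul_one]
  have hfun : (Function.uncurry fun (V1 : GaugeField (F.P p.K) 1 (SU N)) (Uf : GaugeField (F.P p.K) 0 (SU N)) =>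
      (θ.Zt p.K).ζ0 0 Set.univ (pairCfg (V := FluctV N) V1 Uf) * Real.exp (-(1 / 2 : ℝ) * (θ.Zt p.K).quad 0 ∅ (pairCfg (V := FluctV N) V1 Uf))) =
      fun _ => ((Nat.card (Set (Site (F.P p.K) 0)) : ℝ))⁻¹ := by
    funext z
    rcases z with ⟨V1, Uf⟩
    exact hconst V1 Uf
  obtain ⟨Ek, h⟩ := tLaw₁₃CoP_zero_coherence_of_Omega_empty θ p hK hM hT s hΩ (B := |((Nat.card (Set (Site (F.P p.K) 0)) : ℝ))⁻¹|)
    (by rw [hfun]; exact measurable_const) (fun V1 Uf => by rw [hconst V1 Uf])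
  refine ⟨Ek, h.imp id fun hae => ?_⟩
  filter_upwards [hae] with V1 hV1
  rw [hV1]
  have hrew : (fun Uf : GaugeField (F.P p.K) 0 (SU N) =>
        ((θ.Zt p.K).ζ0 0 Set.univ (pairCfg (V := FluctV N) V1 Uf) * Real.exp (-(1 / 2 : ℝ) * (θ.Zt p.K).quad 0 ∅ (pairCfg (V := FluctV N) V1 Uf))) *
          rhoZeroOfRecord F N p.K p.g0 (EOfRecord₁₃ F N θ p) Uf) =
      fun Uf => ((Nat.card (Set (Site (F.P p.K) 0)) : ℝ))⁻¹ * rhoZeroOfRecord F N p.K p.g0 (EOfRecord₁₃ F N θ p) Uf := by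
    funext Uf
    rw [hconst V1 Uf]
  rw [hrew, transportOfRecord_const_mul]
  ring

/-- **… AT EVERY θ CARRYING K0b's RESIDUALS OF RECORD** (`HasResidualsOfRecord`: `Zt = ZtOfRecord` is its third clause) — in particular at K0a's witness
families. [cite: Balaban1988Convergent, Theorem p.245, (3.25) p.270, (3.16) p.268] -/
theorem tLaw₁₃CoP_zero_coherence_of_hasResidualsOfRecord (hres : θ.HasResidualsOfRecord F N) (hK : 0 < p.K) (hM : 1 ≤ θ.τ9.M)
    (hT : TLaw₁₃CoP F N θ p 0) (s : SeqOfRecord F θ.ν θ.τ9.M (gOfRecord₁₃ F N θ p) p.K 1) (hΩ : s.Ω 1 = ∅) :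
    ∃ Ek : ℝ,
      slotsTOfRecord F N θ.ν θ.τ9 (EOfRecord₁₃ F N θ) (wOfRecord₉ F N θ.toStage9Params) θ.ppSel p
          (gOfRecord₁₃ F N θ p) 1 s = 0 ∨
        (fun V1 => transportOfRecord F N p.K 0 (fun U => wOfRecord₉ F N θ.toStage9Params p (gOfRecord₁₃ F N θ p) 0 s U V1 *
            rhoZeroOfRecord F N p.K (gOfRecord₁₃ F N θ p 0) (EOfRecord₁₃ F N θ p) U) V1)
          =ᵐ[fieldMeasure (F.P p.K) 1 (SU N)]
        fun V1 => (((Nat.card (Set (Site (F.P p.K) 0)) : ℝ))⁻¹ * Real.exp (EOfRecord₁₃ F N θ p - Ek)) *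
          transportOfRecord F N p.K 0 (rhoZeroOfRecord F N p.K p.g0 (EOfRecord₁₃ F N θ p)) V1 :=
  tLaw₁₃CoP_zero_coherence_of_Zt_eq_ZtOfRecord θ p hres.Zt_eq hK hM hT s hΩ

end LevelOne

/-! ## §2. The support-edition class and background of record are UNCHANGED along a no-expansion step (`k ≥ 1`); at `k = 0` for EVERY configuration -/

section Backgrounds

variable {ν : Stage7Numerics} {M : ℕ} {g : ℕ → ℝ} {K k : ℕ}

/-- **def-R's SUPPORT-EDITION BACKGROUND OF RECORD IS UNCHANGED ALONG A NO-EXPANSION STEP** (`k ≥ 1`): same averaging, same class, same determining set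
(`genSet_succ_eq_init_of_Omega_empty`) ⇒ the same (2.12) solution map — `U_{k+1}(s′) = U_k(init s′)`. [cite: Balaban1988Convergent, (2.12)–(2.13) pp.256–257, Thm 1 p.262] -/
theorem UbgMSCoPOfRecord_succ_eq_init_of_Omega_empty (hk : 1 ≤ k) (s : SeqOfRecord F ν M g K (k + 1)) (hΩ : s.Ω (k + 1) = ∅) :
    UbgMSCoPOfRecord F N ν M g K (k + 1) s = UbgMSCoPOfRecord F N ν M g K k s.init := by
  funext W
  rw [UbgMSCoPOfRecord_apply, UbgMSCoPOfRecord_apply,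
    regMSCoPOfRecord_succ_eq_of_Omega_empty (N := N) ν K hk hΩ (fun j _ hj => seq_init_Ω_of_le s hj),
    genSet_succ_eq_init_of_Omega_empty hk s hΩ]

/-- **def-R's PRINT-DATUM SUPPORT-EDITION BACKGROUND IS UNCHANGED ALONG A NO-EXPANSION STEP** (`k ≥ 1`): same averaging, same class (`regMSCoPOfRecord_succ_eq_of_Omega_empty`), same
print datum (`…N11BackgroundCoPMeasurableB.lamBondsSeq_succ_eq_of_Omega_empty_of_agree`: `Λ({Ω_j(s′)}_{j≤k+1}) = Λ({Ω_j(init s′)}_{j≤k})` at `Ω_{k+1}(s′) = ∅`) ⇒ the same (2.12) solution map —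
print-datum twin of `UbgMSCoPOfRecord_succ_eq_init_of_Omega_empty` (FLAG №16 ∕ LOCATE-HSEAM 5d3298b8d191f169; the (b)-instance stays landed and true on its own text, just above).
[cite: Balaban1988Convergent, (2.12)–(2.13) pp.256–257, Thm 1 p.262; Balaban1984PropagatorsII, (2.3) p.224] -/
theorem UbgMSCoPOfRecordB_succ_eq_init_of_Omega_empty (hk : 1 ≤ k) (s : SeqOfRecord F ν M g K (k + 1)) (hΩ : s.Ω (k + 1) = ∅) :
    UbgMSCoPOfRecordB F N ν M g K (k + 1) s = UbgMSCoPOfRecordB F N ν M g K k s.init := by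
  funext W
  rw [UbgMSCoPOfRecordB_apply, UbgMSCoPOfRecordB_apply,
    regMSCoPOfRecord_succ_eq_of_Omega_empty (N := N) ν K hk hΩ (fun j _ hj => seq_init_Ω_of_le s hj),
    lamBondsSeq_succ_eq_of_Omega_empty_of_agree hk (fun j hj => seq_init_Ω_of_le s hj) hΩ]

variable (θ : Stage13Params F N) (p : B12.RunParams)

/-- **THE `CoP` BACKGROUND MAP OF RECORD IS UNCHANGED ALONG A NO-EXPANSION STEP, `k ≥ 1`**: `UbgOfRecord₁₃CoP θ p (k+1) s′ = UbgOfRecord₁₃CoP θ p k (init s′)`.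
[cite: Balaban1988Convergent, (2.12)–(2.13) pp.256–257] -/
theorem UbgOfRecord₁₃CoP_succ_eq_init_of_Omega_empty {k : ℕ} (hk : 1 ≤ k)
    (s : SeqOfRecord F θ.ν θ.τ9.M (gOfRecord₁₃ F N θ p) p.K (k + 1)) (hΩ : s.Ω (k + 1) = ∅) :
    UbgOfRecord₁₃CoP F N θ p (k + 1) s = UbgOfRecord₁₃CoP F N θ p k s.init := by
  obtain ⟨k', rfl⟩ : ∃ k', k = k' + 1 := ⟨k - 1, by omega⟩
  -- Stage-2 SEAM-ROBUST (WORKPLAN-IIIB, director-ym №343): (b)-datum background before the `Record13CoP` seam edit, print-datum background after it; the step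
  -- equation holds for both (above), so this proof elaborates in either state of the tree.
  rw [UbgOfRecord₁₃CoP_succ, UbgOfRecord₁₃CoP_succ]
  apply_rules only [hk, hΩ, UbgMSCoPOfRecord_succ_eq_init_of_Omega_empty, UbgMSCoPOfRecordB_succ_eq_init_of_Omega_empty]

/-- **… AND AT `k = 0` FOR EVERY RETAINED CONFIGURATION** (the level-`0` pin `𝐖 ↦ 𝐖 0` of the record against the level-`1` support-edition minimiser, which
reads the fine field unconditionally at `Ω₁ = ∅` — sibling file): `U_1(s′)(𝐖) = U_0(init s′)(𝐖) = 𝐖 0`. [cite: Balaban1988Convergent, Thm 1 p.262, (2.12) p.256, p.248 L17–20] -/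
theorem UbgOfRecord₁₃CoP_one_eq_init_of_Omega_empty (s : SeqOfRecord F θ.ν θ.τ9.M (gOfRecord₁₃ F N θ p) p.K 1) (hΩ : s.Ω 1 = ∅)
    (W : MSField (F.P p.K) (SU N)) : UbgOfRecord₁₃CoP F N θ p 1 s W = UbgOfRecord₁₃CoP F N θ p 0 s.init W := by
  rw [UbgOfRecord₁₃CoP_zero]
  -- Stage-2 SEAM-ROBUST: node00-def-R's `…_one_of_Omega_empty` for the (b)-datum background, its S2c twin for print's datum.
  apply_rules only [hΩ, UbgMSCoPOfRecord_one_of_Omega_empty, UbgMSCoPOfRecordB_one_of_Omega_empty]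

end Backgrounds

end Summit.QuantumFields.YangMills.Theorems.BalabanUVNodesN11NoExpansionAtRecord13CoP

end
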